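import Literature.Probability.Process.SimpleIntegralMartingale
import HarnessLib

/-!
# Covariation of elementary stochastic integrals against two integrators, I: the common grid

First file of three (`ItoIntegralCovariationSimple`, `ItoIntegralCovariationRefined`,
`ItoIntegralCovariation`) proving the **conditional polarised Itô isometry**
`E[Z (J_t - J_s)(J'_t - J'_s)] = c · E[Z ∫_{(s,t]} H_r K_r dr]` for Itô integrals `J = ∫ H dB`,
`J' = ∫ K dB'` against two continuous square-integrable `𝓕`-martingales `B, B'` (raw filtration
`𝓕`, finite measure) whose **covariation is `c t`**: `B_t B'_t - c t` is a martingale (`c = 1` for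
`B' = B` with `⟨B⟩_t = t`; `c = 0` for orthogonal, e.g. independent, Brownian motions — the zero
cross-variation of different coordinates of a multidimensional Brownian motion, which is the
cross-coordinate ingredient of the product rule / Itô formula for SDE systems).

This file: the generic one-cell identity and the case of two bounded simple integrands on a
COMMON grid, between grid points.

* `integral_mul_sub_eq_zero_of_martingale_of_memLp` — martingale increments are orthogonal to
  `L²(𝓕_s)`: `E[G (N_t - N_s)] = 0`;
* `integral_mul_sub_mul_sub_eq` — **one cell**: `E[G (B_b - B_a)(B'_b - B'_a)] = c (b - a) E[G]`
  for bounded `𝓕_a`-measurable `G`;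
* `SimpleProcess.integral_time_eq_sum`, `SimpleProcess.integral_time_sub_integral_time` — the
  elementary integral at grid points is the plain sum of cell increments;
* `SimpleProcess.integral_mul_cellSum_mul_cellSum` — **for `H, K` simple on the same grid,
  grid indices `p ≤ n` and bounded `𝓕(t_p)`-measurable `Z`:
  `E[Z (∑_{p≤i<n} Hᵢ ΔBᵢ)(∑_{p≤i<n} Kᵢ ΔB'ᵢ)] = c E[Z ∑_{p≤i<n} Hᵢ Kᵢ (tᵢ₊₁ - tᵢ)]`**
  (induction over cells: off-diagonal products vanish by orthogonality, the diagonal is the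
  one-cell identity).

Pattern: `SimpleIntegralMartingale` (the isometry `E[(H·B)_t²] = E ∫₀ᵗ H²`, which is the case
`B' = B`, `K = H`, `s = 0`, `Z = 1`).

## References

* D. Revuz, M. Yor, *Continuous Martingales and Brownian Motion* (3rd ed., 1999), Ch. IV,
  Thm (2.2) (the stochastic integral `K·M` is characterised by `⟨K·M, N⟩ = K·⟨M, N⟩`; proof,
  p. 138: orthogonality of martingale increments), Thm (1.8) (the bracket).
* J.-F. Le Gall, *Brownian Motion, Martingales, and Stochastic Calculus* (2016), Thm 5.4 and
  eq. (5.6) (`E[(∫H dM)(∫K dN)] = E ∫ H K d⟨M, N⟩`).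
-/

open MeasureTheory ProbabilityTheory Filter Finset
open scoped NNReal ENNReal Topology

noncomputable section

namespace Literature.Probability.Process

variable {Ω : Type*} {m : MeasurableSpace Ω} {𝓕 : Filtration ℝ≥0 m} {μ : Measure Ω}

/-! ### Orthogonality of martingale increments to `L²(𝓕_s)` and the one-cell covariation -/

section Generic

variable [IsFiniteMeasure μ] {B B' : ℝ≥0 → Ω → ℝ} {c : ℝ}

/-- **Martingale increments are orthogonal to square-integrable `𝓕_s`-measurable weights**:
`E[G (N_t - N_s)] = 0` for `G ∈ L²` strongly `𝓕_s`-measurable and `N` a square-integrable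
martingale.
[cite: RevuzYor1999, Ch. IV Thm (2.2) (proof, p. 138: orthogonality of martingale increments)] -/
theorem integral_mul_sub_eq_zero_of_martingale_of_memLp {N : ℝ≥0 → Ω → ℝ} (hN : Martingale N 𝓕 μ)
    (hN2 : ∀ t, MemLp (N t) 2 μ) {s t : ℝ≥0} (hst : s ≤ t) {G : Ω → ℝ}
    (hG : StronglyMeasurable[𝓕 s] G) (hG2 : MemLp G 2 μ) :
    ∫ ω, G ω * (N t ω - N s ω) ∂μ = 0 := by
  set ξ : Ω → ℝ := fun ω ↦ N t ω - N s ω with hξdef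
  have hξ : Integrable ξ μ := (hN.integrable t).sub (hN.integrable s)
  have hGξ : Integrable (G * ξ) μ := hG2.integrable_mul ((hN2 t).sub (hN2 s))
  have h0 : μ[ξ | 𝓕 s] =ᵐ[μ] 0 := by
    have h1 := hN.2 s t hst
    have h2 : μ[ξ | 𝓕 s] =ᵐ[μ] μ[N t | 𝓕 s] - μ[N s | 𝓕 s] :=
      condExp_sub (hN.integrable t) (hN.integrable s) _
    have h3 : μ[N s | 𝓕 s] = N s := condExp_of_stronglyMeasurable (𝓕.le s) (hN.1 s) (hN.integrable s)
    filter_upwards [h1, h2] with ω hω1 hω2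
    rw [hω2, Pi.sub_apply, hω1, h3, sub_self, Pi.zero_apply]
  have h1 : ∫ ω, (G * ξ) ω ∂μ = ∫ ω, (μ[G * ξ | 𝓕 s]) ω ∂μ := (integral_condExp (𝓕.le s)).symm
  have h2 := condExp_mul_of_stronglyMeasurable_left (μ := μ) hG hGξ hξ
  have h3 : ∫ ω, (μ[G * ξ | 𝓕 s]) ω ∂μ = ∫ ω, (0 : ℝ) ∂μ := by
    refine integral_congr_ae ?_
    filter_upwards [h2, h0] with ω hω hω'
    rw [hω, Pi.mul_apply, hω', Pi.zero_apply, mul_zero]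
  have h4 : ∫ ω, G ω * (N t ω - N s ω) ∂μ = ∫ ω, (G * ξ) ω ∂μ := rfl
  rw [h4, h1, h3, integral_zero]

/-- **One-cell covariation identity**: if `B, B'` are square-integrable martingales and
`B_t B'_t - c t` is a martingale, then `E[G (B_b - B_a)(B'_b - B'_a)] = c (b - a) E[G]` for
`a ≤ b` and every bounded `𝓕_a`-measurable `G` (expand
`ΔB ΔB' = (B_b B'_b - B_a B'_a) - B_a ΔB' - B'_a ΔB` and use orthogonality of the three
martingale increments to `L²(𝓕_a)`).
This is the defining property of the bracket `⟨B, B'⟩_t = c t`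
(`E[(M_t - M_s)(N_t - N_s) | 𝓕_s] = E[⟨M,N⟩_t - ⟨M,N⟩_s | 𝓕_s]`) over one cell.
[cite: RevuzYor1999, Ch. IV Thm (1.9) (the bracket `⟨M,N⟩`: `MN - ⟨M,N⟩` is a martingale)] -/
theorem integral_mul_sub_mul_sub_eq (hB : Martingale B 𝓕 μ) (hB' : Martingale B' 𝓕 μ)
    (hB2 : ∀ t, MemLp (B t) 2 μ) (hB'2 : ∀ t, MemLp (B' t) 2 μ)
    (hcov : Martingale (fun t ω ↦ B t ω * B' t ω - c * (t : ℝ)) 𝓕 μ)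
    {a b : ℝ≥0} (hab : a ≤ b) {G : Ω → ℝ} (hG : StronglyMeasurable[𝓕 a] G) {C : ℝ}
    (hC : ∀ ω, |G ω| ≤ C) :
    ∫ ω, G ω * ((B b ω - B a ω) * (B' b ω - B' a ω)) ∂μ = c * ((b : ℝ) - a) * ∫ ω, G ω ∂μ := by
  have hGm : AEStronglyMeasurable G μ := (hG.mono (𝓕.le a)).aestronglyMeasurable
  have hGbdd : ∀ᵐ ω ∂μ, ‖G ω‖ ≤ C := ae_of_all _ fun ω ↦ by simpa [Real.norm_eq_abs] using hC ω
  -- the three increments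
  have hΔB : MemLp (fun ω ↦ B b ω - B a ω) 2 μ := (hB2 b).sub (hB2 a)
  have hΔB' : MemLp (fun ω ↦ B' b ω - B' a ω) 2 μ := (hB'2 b).sub (hB'2 a)
  -- (1) the bracket martingale
  have h1 : ∫ ω, G ω * ((B b ω * B' b ω - c * (b : ℝ)) - (B a ω * B' a ω - c * (a : ℝ))) ∂μ = 0 := by
    have hGs : Measurable[𝓕 a] G := hG.measurable
    -- bounded-weight orthogonality, proved inline (as `integral_mul_sub_eq_zero_of_martingale`)
    set ξ : Ω → ℝ := fun ω ↦ (B b ω * B' b ω - c * (b : ℝ)) - (B a ω * B' a ω - c * (a : ℝ)) with hξ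
    have hξi : Integrable ξ μ := (hcov.integrable b).sub (hcov.integrable a)
    have hGξ : Integrable (G * ξ) μ := hξi.bdd_mul hGm hGbdd
    have h0 : μ[ξ | 𝓕 a] =ᵐ[μ] 0 := by
      have h1 := hcov.2 a b hab
      have h2 : μ[ξ | 𝓕 a] =ᵐ[μ] μ[fun ω ↦ B b ω * B' b ω - c * (b : ℝ) | 𝓕 a] -
          μ[fun ω ↦ B a ω * B' a ω - c * (a : ℝ) | 𝓕 a] :=
        condExp_sub (hcov.integrable b) (hcov.integrable a) _
      have h3 : μ[fun ω ↦ B a ω * B' a ω - c * (a : ℝ) | 𝓕 a] =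
          fun ω ↦ B a ω * B' a ω - c * (a : ℝ) :=
        condExp_of_stronglyMeasurable (𝓕.le a) (hcov.1 a) (hcov.integrable a)
      filter_upwards [h1, h2] with ω hω1 hω2
      rw [hω2, Pi.sub_apply, hω1, h3, sub_self, Pi.zero_apply]
    have e1 : ∫ ω, (G * ξ) ω ∂μ = ∫ ω, (μ[G * ξ | 𝓕 a]) ω ∂μ := (integral_condExp (𝓕.le a)).symm
    have e2 := condExp_mul_of_stronglyMeasurable_left (μ := μ) hG hGξ hξi
    have e3 : ∫ ω, (μ[G * ξ | 𝓕 a]) ω ∂μ = ∫ ω, (0 : ℝ) ∂μ := by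
      refine integral_congr_ae ?_
      filter_upwards [e2, h0] with ω hω hω'
      rw [hω, Pi.mul_apply, hω', Pi.zero_apply, mul_zero]
    have e4 : ∫ ω, G ω * ξ ω ∂μ = ∫ ω, (G * ξ) ω ∂μ := rfl
    rw [e4, e1, e3, integral_zero]
  -- (2) `E[G B_a ΔB'] = 0` and (3) `E[G B'_a ΔB] = 0`
  have h2 : ∫ ω, G ω * B a ω * (B' b ω - B' a ω) ∂μ = 0 :=
    integral_mul_sub_eq_zero_of_martingale_of_memLp hB' hB'2 hab (hG.mul (hB.1 a))
      (memLp_two_bdd_mul hGm hC (hB2 a))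
  have h3 : ∫ ω, G ω * B' a ω * (B b ω - B a ω) ∂μ = 0 :=
    integral_mul_sub_eq_zero_of_martingale_of_memLp hB hB2 hab (hG.mul (hB'.1 a))
      (memLp_two_bdd_mul hGm hC (hB'2 a))
  -- integrability of the pieces
  have iGBB : Integrable (fun ω ↦ G ω * ((B b ω * B' b ω - c * (b : ℝ)) -
      (B a ω * B' a ω - c * (a : ℝ)))) μ :=
    ((hcov.integrable b).sub (hcov.integrable a)).bdd_mul hGm hGbdd
  have i2 : Integrable (fun ω ↦ G ω * B a ω * (B' b ω - B' a ω)) μ :=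
    (memLp_two_bdd_mul hGm hC (hB2 a)).integrable_mul hΔB'
  have i3 : Integrable (fun ω ↦ G ω * B' a ω * (B b ω - B a ω)) μ :=
    (memLp_two_bdd_mul hGm hC (hB'2 a)).integrable_mul hΔB
  have iG : Integrable G μ := (integrable_const C).mono' hGm hGbdd
  -- algebra: `G ΔB ΔB' = G[(BB'-cb) - (B_aB'_a - ca)] - G B_a ΔB' - G B'_a ΔB + c (b - a) G`
  have halg : (fun ω ↦ G ω * ((B b ω - B a ω) * (B' b ω - B' a ω))) = fun ω ↦
      G ω * ((B b ω * B' b ω - c * (b : ℝ)) - (B a ω * B' a ω - c * (a : ℝ))) -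
        G ω * B a ω * (B' b ω - B' a ω) - G ω * B' a ω * (B b ω - B a ω) +
        c * ((b : ℝ) - a) * G ω := by
    ext ω; ring
  have i12 : Integrable (fun ω ↦ G ω * ((B b ω * B' b ω - c * (b : ℝ)) -
      (B a ω * B' a ω - c * (a : ℝ))) - G ω * B a ω * (B' b ω - B' a ω)) μ := iGBB.sub i2
  have i123 : Integrable (fun ω ↦ G ω * ((B b ω * B' b ω - c * (b : ℝ)) -
      (B a ω * B' a ω - c * (a : ℝ))) - G ω * B a ω * (B' b ω - B' a ω) -
      G ω * B' a ω * (B b ω - B a ω)) μ := i12.sub i3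
  have iG' : Integrable (fun ω ↦ c * ((b : ℝ) - a) * G ω) μ := iG.const_mul _
  rw [halg, integral_add i123 iG', integral_sub i12 i3, integral_sub iGBB i2, h1, h2, h3,
    integral_const_mul]
  ring

end Generic

/-! ### Two simple integrands on a common grid -/

namespace SimpleProcess

section Grid

variable {B B' : ℝ≥0 → Ω → ℝ}

/-- **The elementary integral at a grid point** is the plain sum of the cell increments up to
that point: `(H·B)_{t_q} = ∑_{i<q} Hᵢ (B_{tᵢ₊₁} - B_{tᵢ})`.
[cite: RevuzYor1999, Ch. IV §2, display after Def. (2.3) (the elementary stochastic integral)] -/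
theorem integral_time_eq_sum (H : SimpleProcess m 𝓕) (B : ℝ≥0 → Ω → ℝ) {q : ℕ}
    (hq : q < H.times.length) (ω : Ω) :
    H.integral B (H.time q) ω =
      ∑ i ∈ range q, H.value i ω * (B (H.time (i + 1)) ω - B (H.time i) ω) := by
  unfold integral
  rw [← sum_range_add_sum_Ico _ (show q ≤ H.times.length - 1 by omega)]
  have hzero : ∑ i ∈ Ico q (H.times.length - 1),
      H.value i ω * (B (min (H.time q) (H.time (i + 1))) ω - B (min (H.time q) (H.time i)) ω) = 0 := by
    refine sum_eq_zero fun i hi ↦ ?_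
    have hi' := mem_Ico.1 hi
    have h1 : min (H.time q) (H.time (i + 1)) = H.time q :=
      min_eq_left (H.time_mono (by omega) (by omega))
    have h2 : min (H.time q) (H.time i) = H.time q := min_eq_left (H.time_mono hi'.1 (by omega))
    rw [h1, h2, sub_self, mul_zero]
  rw [hzero, add_zero]
  refine sum_congr rfl fun i hi ↦ ?_
  have hi' := mem_range.1 hi
  have h1 : min (H.time q) (H.time (i + 1)) = H.time (i + 1) :=
    min_eq_right (H.time_mono (by omega) hq)
  have h2 : min (H.time q) (H.time i) = H.time i := min_eq_right (H.time_mono hi'.le hq)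
  rw [h1, h2]

/-- The increment of the elementary integral between two grid points `t_p ≤ t_q` is the sum of
the cell increments over the cells `p ≤ i < q`.
[cite: RevuzYor1999, Ch. IV §2, display after Def. (2.3) (the elementary stochastic integral)] -/
theorem integral_time_sub_integral_time (H : SimpleProcess m 𝓕) (B : ℝ≥0 → Ω → ℝ) {p q : ℕ}
    (hpq : p ≤ q) (hq : q < H.times.length) (ω : Ω) :
    H.integral B (H.time q) ω - H.integral B (H.time p) ω =
      ∑ i ∈ Ico p q, H.value i ω * (B (H.time (i + 1)) ω - B (H.time i) ω) := by
  rw [H.integral_time_eq_sum B hq, H.integral_time_eq_sum B (lt_of_le_of_lt hpq hq),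
    ← sum_range_add_sum_Ico _ hpq, add_sub_cancel_left]

/-- The partial cell sum `∑_{p ≤ i < n} Hᵢ (B_{tᵢ₊₁} - B_{tᵢ})` is `𝓕 (tₙ)`-measurable.
[folklore] -/
private theorem stronglyMeasurable_cellSum (H : SimpleProcess m 𝓕) (hB : StronglyAdapted 𝓕 B) {p n : ℕ}
    (hn : n < H.times.length) :
    StronglyMeasurable[𝓕 (H.time n)]
      (fun ω ↦ ∑ i ∈ Ico p n, H.value i ω * (B (H.time (i + 1)) ω - B (H.time i) ω)) := by
  refine Finset.stronglyMeasurable_fun_sum _ fun i hi ↦ ?_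
  have hi' := mem_Ico.1 hi
  have h1 : H.time i ≤ H.time n := H.time_mono hi'.2.le hn
  have h2 : H.time (i + 1) ≤ H.time n := H.time_mono (by omega) hn
  exact ((H.stronglyMeasurable_value (by omega)).mono (𝓕.mono h1)).mul
    (((hB _).mono (𝓕.mono h2)).sub ((hB _).mono (𝓕.mono h1)))

/-- The partial cell sum is square integrable when the integrator is. [folklore] -/
private theorem memLp_cellSum (H : SimpleProcess m 𝓕)
    (hB2 : ∀ t, MemLp (B t) 2 μ) (p n : ℕ) (hn : n < H.times.length) :
    MemLp (fun ω ↦ ∑ i ∈ Ico p n, H.value i ω * (B (H.time (i + 1)) ω - B (H.time i) ω)) 2 μ := by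
  refine memLp_finsetSum _ fun i hi ↦ ?_
  have hi' := mem_Ico.1 hi
  obtain ⟨C, hC⟩ := H.bounded
  exact memLp_two_bdd_mul ((H.stronglyMeasurable_value' (by omega)).aestronglyMeasurable)
    (fun ω ↦ hC i ω) ((hB2 _).sub (hB2 _))

variable [IsFiniteMeasure μ] {c : ℝ}

/-- **Covariation of two elementary integrals on a common grid** (induction over the cells):
for bounded simple `H, K` with the same partition, grid indices `p ≤ n`, and a bounded
`𝓕 (t_p)`-measurable weight `Z`,
`E[Z (∑_{p≤i<n} Hᵢ ΔBᵢ)(∑_{p≤i<n} Kᵢ ΔB'ᵢ)] = c E[Z ∑_{p≤i<n} Hᵢ Kᵢ (tᵢ₊₁ - tᵢ)]`: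
off-diagonal products vanish (orthogonality of martingale increments to `L²` of the past), the
diagonal is the one-cell identity `integral_mul_sub_mul_sub_eq`.
This is `(H·B)(K·B') - HK·⟨B, B'⟩` being a martingale (Revuz–Yor's `⟨K·M, N⟩ = K·⟨M,N⟩`)
for elementary integrands, in conditional-expectation form along the grid.
[cite: RevuzYor1999, Ch. IV Thm (2.2) (`(K·M)N - K·⟨M,N⟩` is a martingale; proof p. 138)] -/
theorem integral_mul_cellSum_mul_cellSum (H K : SimpleProcess m 𝓕) (hHK : K.times = H.times)
    (hB : Martingale B 𝓕 μ) (hB' : Martingale B' 𝓕 μ)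
    (hB2 : ∀ t, MemLp (B t) 2 μ) (hB'2 : ∀ t, MemLp (B' t) 2 μ)
    (hcov : Martingale (fun t ω ↦ B t ω * B' t ω - c * (t : ℝ)) 𝓕 μ)
    {p n : ℕ} (hpn : p ≤ n) (hn : n < H.times.length) {Z : Ω → ℝ}
    (hZ : StronglyMeasurable[𝓕 (H.time p)] Z) {C : ℝ} (hC : ∀ ω, |Z ω| ≤ C) :
    ∫ ω, Z ω * ((∑ i ∈ Ico p n, H.value i ω * (B (H.time (i + 1)) ω - B (H.time i) ω)) *
        (∑ i ∈ Ico p n, K.value i ω * (B' (H.time (i + 1)) ω - B' (H.time i) ω))) ∂μ =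
      c * ∫ ω, Z ω * ∑ i ∈ Ico p n,
        H.value i ω * K.value i ω * ((H.time (i + 1) : ℝ) - H.time i) ∂μ := by
  have hKt : ∀ i, K.time i = H.time i := fun i ↦ by simp only [SimpleProcess.time, hHK]
  have hKlen : K.times.length = H.times.length := by rw [hHK]
  obtain ⟨CH, hCH⟩ := H.bounded
  obtain ⟨CK, hCK⟩ := K.bounded
  have hZm : AEStronglyMeasurable Z μ := (hZ.mono (𝓕.le _)).aestronglyMeasurable
  -- induction on `n` from `p`
  induction n, hpn using Nat.le_induction with
  | base => simp
  | succ n hpn ih =>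
    have hn' : n < H.times.length := by omega
    have ih := ih hn'
    -- abbreviations
    set Sx : Ω → ℝ := fun ω ↦ ∑ i ∈ Ico p n, H.value i ω * (B (H.time (i + 1)) ω - B (H.time i) ω)
      with hSx
    set Sy : Ω → ℝ := fun ω ↦ ∑ i ∈ Ico p n, K.value i ω * (B' (H.time (i + 1)) ω - B' (H.time i) ω)
      with hSy
    set ΔB : Ω → ℝ := fun ω ↦ B (H.time (n + 1)) ω - B (H.time n) ω with hΔB
    set ΔB' : Ω → ℝ := fun ω ↦ B' (H.time (n + 1)) ω - B' (H.time n) ω with hΔB'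
    set R : Ω → ℝ := fun ω ↦ ∑ i ∈ Ico p n,
      H.value i ω * K.value i ω * ((H.time (i + 1) : ℝ) - H.time i) with hR
    have htn : H.time n ≤ H.time (n + 1) := H.time_mono (Nat.le_succ n) hn
    have htp : H.time p ≤ H.time n := H.time_mono hpn hn'
    -- measurability / integrability
    have hZn : StronglyMeasurable[𝓕 (H.time n)] Z := hZ.mono (𝓕.mono htp)
    have hSxm : StronglyMeasurable[𝓕 (H.time n)] Sx := H.stronglyMeasurable_cellSum hB.1 hn'
    have hSym : StronglyMeasurable[𝓕 (H.time n)] Sy := by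
      refine Finset.stronglyMeasurable_fun_sum _ fun i hi ↦ ?_
      have hi' := mem_Ico.1 hi
      have h1 : H.time i ≤ H.time n := H.time_mono hi'.2.le hn'
      have h2 : H.time (i + 1) ≤ H.time n := H.time_mono (by omega) hn'
      exact ((K.stronglyMeasurable_value (i := i) (by omega)).mono
        (by rw [hKt]; exact 𝓕.mono h1)).mul
        (((hB'.1 _).mono (𝓕.mono h2)).sub ((hB'.1 _).mono (𝓕.mono h1)))
    have hSx2 : MemLp Sx 2 μ := H.memLp_cellSum hB2 p n hn'
    have hSy2 : MemLp Sy 2 μ := by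
      have := K.memLp_cellSum hB'2 p n (B := B') (by omega)
      simpa only [hKt] using this
    have hHn : StronglyMeasurable[𝓕 (H.time n)] (H.value n) := H.stronglyMeasurable_value hn'
    have hKn : StronglyMeasurable[𝓕 (H.time n)] (K.value n) := by
      have := K.stronglyMeasurable_value (i := n) (by omega); rwa [hKt] at this
    have hΔB2 : MemLp ΔB 2 μ := (hB2 _).sub (hB2 _)
    have hΔB'2 : MemLp ΔB' 2 μ := (hB'2 _).sub (hB'2 _)
    have hZK : ∀ ω, |Z ω * K.value n ω| ≤ C * CK := fun ω ↦ by
      rw [abs_mul]; exact mul_le_mul (hC ω) (hCK n ω) (abs_nonneg _) ((abs_nonneg _).trans (hC ω))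
    have hZH : ∀ ω, |Z ω * H.value n ω| ≤ C * CH := fun ω ↦ by
      rw [abs_mul]; exact mul_le_mul (hC ω) (hCH n ω) (abs_nonneg _) ((abs_nonneg _).trans (hC ω))
    have hZHK : ∀ ω, |Z ω * H.value n ω * K.value n ω| ≤ C * CH * CK := fun ω ↦ by
      rw [abs_mul]
      exact mul_le_mul (hZH ω) (hCK n ω) (abs_nonneg _)
        ((abs_nonneg _).trans (hZH ω))
    -- the four terms
    -- T2: `E[(Z Kₙ Sx) ΔB'] = 0`
    have hT2 : ∫ ω, Z ω * K.value n ω * Sx ω * ΔB' ω ∂μ = 0 :=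
      integral_mul_sub_eq_zero_of_martingale_of_memLp hB' hB'2 htn ((hZn.mul hKn).mul hSxm)
        (memLp_two_bdd_mul ((hZn.mul hKn).mono (𝓕.le _)).aestronglyMeasurable hZK hSx2)
    -- T3: `E[(Z Hₙ Sy) ΔB] = 0`
    have hT3 : ∫ ω, Z ω * H.value n ω * Sy ω * ΔB ω ∂μ = 0 :=
      integral_mul_sub_eq_zero_of_martingale_of_memLp hB hB2 htn ((hZn.mul hHn).mul hSym)
        (memLp_two_bdd_mul ((hZn.mul hHn).mono (𝓕.le _)).aestronglyMeasurable hZH hSy2)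
    -- T4: the diagonal cell
    have hT4 : ∫ ω, Z ω * H.value n ω * K.value n ω * (ΔB ω * ΔB' ω) ∂μ =
        c * ((H.time (n + 1) : ℝ) - H.time n) * ∫ ω, Z ω * H.value n ω * K.value n ω ∂μ :=
      integral_mul_sub_mul_sub_eq hB hB' hB2 hB'2 hcov htn ((hZn.mul hHn).mul hKn) hZHK
    -- integrability of the four terms and of the right-hand sides
    have iT1 : Integrable (fun ω ↦ Z ω * (Sx ω * Sy ω)) μ :=
      (hSx2.integrable_mul hSy2).bdd_mul hZm
        (ae_of_all _ fun ω ↦ by simpa [Real.norm_eq_abs] using hC ω)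
    have iT2 : Integrable (fun ω ↦ Z ω * K.value n ω * Sx ω * ΔB' ω) μ :=
      (memLp_two_bdd_mul ((hZn.mul hKn).mono (𝓕.le _)).aestronglyMeasurable hZK hSx2).integrable_mul
        hΔB'2
    have iT3 : Integrable (fun ω ↦ Z ω * H.value n ω * Sy ω * ΔB ω) μ :=
      (memLp_two_bdd_mul ((hZn.mul hHn).mono (𝓕.le _)).aestronglyMeasurable hZH hSy2).integrable_mul
        hΔB2
    have iT4 : Integrable (fun ω ↦ Z ω * H.value n ω * K.value n ω * (ΔB ω * ΔB' ω)) μ :=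
      (hΔB2.integrable_mul hΔB'2).bdd_mul
        (((hZn.mul hHn).mul hKn).mono (𝓕.le _)).aestronglyMeasurable
        (ae_of_all _ fun ω ↦ by simpa [Real.norm_eq_abs] using hZHK ω)
    have iR : Integrable (fun ω ↦ Z ω * R ω) μ := by
      have hRm : StronglyMeasurable[𝓕 (H.time n)] R := by
        refine Finset.stronglyMeasurable_fun_sum _ fun i hi ↦ ?_
        have hi' := mem_Ico.1 hi
        have h1 : H.time i ≤ H.time n := H.time_mono hi'.2.le hn'
        exact (((H.stronglyMeasurable_value (by omega)).mono (𝓕.mono h1)).mul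
          ((K.stronglyMeasurable_value (i := i) (by omega)).mono
            (by rw [hKt]; exact 𝓕.mono h1))).mul stronglyMeasurable_const
      have hRb : ∀ ω, |R ω| ≤ ∑ i ∈ Ico p n, CH * CK * |((H.time (i + 1) : ℝ) - H.time i)| :=
        fun ω ↦ (abs_sum_le_sum_abs _ _).trans (sum_le_sum fun i _ ↦ by
          rw [abs_mul, abs_mul]
          exact mul_le_mul (mul_le_mul (hCH i ω) (hCK i ω) (abs_nonneg _)
            ((abs_nonneg _).trans (hCH i ω))) le_rfl (abs_nonneg _)
            (mul_nonneg ((abs_nonneg _).trans (hCH i ω)) ((abs_nonneg _).trans (hCK i ω))))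
      have iR' : Integrable R μ := (integrable_const _).mono' (hRm.mono (𝓕.le _)).aestronglyMeasurable
        (ae_of_all _ fun ω ↦ by rw [Real.norm_eq_abs]; exact hRb ω)
      exact iR'.bdd_mul hZm (ae_of_all _ fun ω ↦ by simpa [Real.norm_eq_abs] using hC ω)
    have iD : Integrable (fun ω ↦ Z ω * H.value n ω * K.value n ω) μ :=
      (integrable_const (C * CH * CK)).mono'
        (((hZn.mul hHn).mul hKn).mono (𝓕.le _)).aestronglyMeasurable
        (ae_of_all _ fun ω ↦ by rw [Real.norm_eq_abs]; exact hZHK ω)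
    -- expand the `(n+1)`-st sums
    have hsucc : ∀ ω, (∑ i ∈ Ico p (n + 1), H.value i ω * (B (H.time (i + 1)) ω - B (H.time i) ω)) *
        (∑ i ∈ Ico p (n + 1), K.value i ω * (B' (H.time (i + 1)) ω - B' (H.time i) ω)) =
        Sx ω * Sy ω + K.value n ω * Sx ω * ΔB' ω + H.value n ω * Sy ω * ΔB ω +
          H.value n ω * K.value n ω * (ΔB ω * ΔB' ω) := by
      intro ω
      rw [sum_Ico_succ_top hpn, sum_Ico_succ_top hpn]
      ring
    have hsuccR : ∀ ω, ∑ i ∈ Ico p (n + 1), H.value i ω * K.value i ω * ((H.time (i + 1) : ℝ) - H.time i)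
        = R ω + H.value n ω * K.value n ω * ((H.time (n + 1) : ℝ) - H.time n) := by
      intro ω
      rw [sum_Ico_succ_top hpn]
    have hlhs : (fun ω ↦ Z ω * ((∑ i ∈ Ico p (n + 1), H.value i ω * (B (H.time (i + 1)) ω - B (H.time i) ω)) *
        (∑ i ∈ Ico p (n + 1), K.value i ω * (B' (H.time (i + 1)) ω - B' (H.time i) ω)))) =
        fun ω ↦ Z ω * (Sx ω * Sy ω) + Z ω * K.value n ω * Sx ω * ΔB' ω +
          Z ω * H.value n ω * Sy ω * ΔB ω + Z ω * H.value n ω * K.value n ω * (ΔB ω * ΔB' ω) := by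
      ext ω; rw [hsucc ω]; ring
    have hrhs : (fun ω ↦ Z ω * ∑ i ∈ Ico p (n + 1),
        H.value i ω * K.value i ω * ((H.time (i + 1) : ℝ) - H.time i)) =
        fun ω ↦ Z ω * R ω + ((H.time (n + 1) : ℝ) - H.time n) * (Z ω * H.value n ω * K.value n ω) := by
      ext ω; rw [hsuccR ω]; ring
    have i12 : Integrable (fun ω ↦ Z ω * (Sx ω * Sy ω) + Z ω * K.value n ω * Sx ω * ΔB' ω) μ :=
      iT1.add iT2
    have i123 : Integrable (fun ω ↦ Z ω * (Sx ω * Sy ω) + Z ω * K.value n ω * Sx ω * ΔB' ω +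
        Z ω * H.value n ω * Sy ω * ΔB ω) μ := i12.add iT3
    have iD' : Integrable (fun ω ↦ ((H.time (n + 1) : ℝ) - H.time n) *
        (Z ω * H.value n ω * K.value n ω)) μ := iD.const_mul _
    rw [hlhs, hrhs, integral_add i123 iT4, integral_add i12 iT3, integral_add iT1 iT2, hT2, hT3, hT4,
      integral_add iR iD', integral_const_mul]
    have ih' : ∫ ω, Z ω * (Sx ω * Sy ω) ∂μ = c * ∫ ω, Z ω * R ω ∂μ := ih
    rw [ih']
    ring

end Grid

end SimpleProcess

end Literature.Probability.Process

end
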